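import Literature.NumberTheory.EllipticCurves.MordellCurveThreeDescentLocal
import HarnessLib

/-!
# Local necessity for the torsor classes `[C_a]` of the Mordell curves `y² = x³ − 3c²`:
# `[C_a]` restricts to zero at a `K`-field `E` only if `a ∈ δ(E'(E)) · E*³`

Topic `NumberTheory/EllipticCurves`. Converse of `MordellCurveThreeDescentLocal`
(`MordellDescent.torsorClass_mem_localRestrictionKer`: `a ∈ δ(E'(E)) E*³ ⇒ res_E [C_a] = 0`) in the
programme `MordellCurveThreeDescent` → `…Kernel` → `…Local` (Cassels 1964, *Arithmetic on curves of
genus 1, VI*; Silverman *AEC* X.4). Everything here is proved; no definitions, no named facts.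

**The theorem** (`MordellDescent.exists_phiDescent_eq_of_torsorClass_mem_localRestrictionKer`). Let
`K` have characteristic `0`, `c ∈ K*`, `D = −3c²`, `E_D : y² = x³ + D`, `E' = E_{81c²} : Y² = X³ + 81c²`,
`δ = phiDescent c : E'(·) → ·` (`O ↦ 1`, `−T' ↦ (18c)²`, `(X, Y) ↦ Y + 9c`), and let `E ⊇ K` be any
field (a completion `K_v`). If the torsor class `[C_a] ∈ H¹(K, E_D)` of `a ∈ K*` lies in the local
kernel `WeierstrassCurve.localRestrictionKer (mordellCurve D) E` — i.e. restricts to zero in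
`H¹(E, E_D(Ē))` — then `a` is a descent value over `E`:

  `phiDescent c P' = a · w³` for some `P' ∈ E'(E)`, `w ∈ E*`.

With the tree's sufficiency this is Cassels' "`m` maps into an element of `Ш` if and ONLY IF there
is everywhere locally a point on (2)" (p. 65), place by place; equivalently the LOCAL CONDITIONS of
the `φ`-Selmer group `Sel^φ(E_D/K) ⊆ K*/K*³` (Silverman, *AEC*, Thm. X.4.2 and Prop. X.4.9: `ξ ∈
Sel^φ` iff `res_v ξ` comes from `E'(K_v)` for every `v`) are NECESSARY for membership in `Ш`: a class
`[C_a] ∈ Ш(E_D/K)` has `a ∈ δ(E'(K_v)) K_v*³` at every completion, so that any explicit confinement of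
the local images `δ(E'(K_v))` (valuations, residue characters:
`Literature.NumberTheory.EllipticCurves.MordellCurveCubicDescentLocal`) bounds `Ш(E_D/K) ∩ im [C_·]`
from above — the Selmer side of a complete `3`-descent, as opposed to the rank side, which only
needs the images of GLOBAL points.

Proof: the kernel theorem of `MordellCurveThreeDescentKernel` (`[C_a] = 0 ⇒ a ∈ δ(E'(K)) K*³`) redone
over `E` with the transported data of `MordellCurveThreeDescentLocal` — the local Vélu pair
`isVeluThreePair_local` with kernel point `T_E = (0, c ι√−3)`, the cube root `ι∛a ∈ Ē` on which
`τ ∈ Γ_E` acts through `ι(ω)^{n(τ)}`, `n(τ) = kummerExp a (τ|_K̄)` (`galAutE_iotaE_cubeRoot`). A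
restricted coboundary `n(τ) T_E = τ b − b`, `b ∈ E_D(Ē)`, gives: for `b ∈ {O, ±T_E}`,
`n(τ) = (ε(τ) − 1) j` on `Γ_E`, whence `ι(ω)^{−j} ι∛a` is `Γ_E`-fixed and `a ∈ E*³` (`P' = O`); for
`b = (x, y)`, `x ≠ 0`, the point `P' = φ(b)` is `Γ_E`-fixed hence `E`-rational, and
`g_{±c}(b) (ι∛a)^e` (`e = 2, 1`) is `Γ_E`-fixed with cube `(Y(P') ± 9c) a^e` (the `g`-function
argument, `gFunW_pow_three`, `gFunW_add_nsmul_T`), which exhibits `δ(P')` as `a` times a cube.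

## References

* [Cassels1964ArithmeticVI] J. W. S. Cassels, *Arithmetic on curves of genus 1. VI. The
  Tate–Šafarevič group can be arbitrarily large*, J. reine angew. Math. 214/215 (1964) 65–70, p. 65.
* [SilvermanAEC2009] J. H. Silverman, *The Arithmetic of Elliptic Curves*, 2nd ed., GTM 106 (2009),
  Thm. X.4.2 and Prop. X.4.9 (the local conditions cutting out the Selmer group of an isogeny).
* Tree: `MordellCurveThreeDescentKernel` (`exists_phiDescent_eq_of_torsorClass_eq_zero`, the model),
  `MordellCurveThreeDescentLocal` (local set-up and the converse direction).
-/

noncomputable section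

open scoped Classical

open WeierstrassCurve

universe u

namespace Literature.NumberTheory.EllipticCurves

namespace MordellDescent

variable {K : Type u} [Field K] [CharZero K]
variable {D c : K} (hc : c ≠ 0) (hD : D = -3 * c ^ 2)
variable {E : Type u} [Field E] [Algebra K E]

/-! ## Local plumbing: Galois descent over `E`, the action on the Vélu coordinates and on `g_e` -/

omit [CharZero K] in
/-- Galois descent in `Ē/E`: a `Γ_E`-fixed element of `Ē` lies in `E`. [folklore] -/
private theorem exists_algebraMap_eq_of_forall_galAutE [CharZero E] {x : AlgebraicClosure E}
    (hx : ∀ τ : Field.absoluteGaloisGroup E, galAutE E τ x = x) :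
    ∃ b : E, algebraMap E (AlgebraicClosure E) b = x :=
  exists_algebraMap_eq_of_forall_galAut (K := E) hx

omit [CharZero K] in
/-- `Γ_E` fixes `E`. [folklore] -/
private theorem galAutE_algebraMap (τ : Field.absoluteGaloisGroup E) (e : E) :
    galAutE E τ (algebraMap E (AlgebraicClosure E) e) = algebraMap E (AlgebraicClosure E) e :=
  (galAutE E τ).commutes e

/-! ## The converse of the local condition -/

/-- **Local necessity.** For a `K`-field `E`: if the torsor class `[C_a]` of `a ∈ K*` restricts to
zero in `H¹(E, E_D(Ē))` (`[C_a] ∈ localRestrictionKer (mordellCurve D) E`), then `a` is a descent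
value over `E` — `phiDescent c P' = a w³` for some `P' ∈ E'(E) = E_{81c²}(E)` and `w ∈ E*`. With
`torsorClass_mem_localRestrictionKer` (the converse): `res_E [C_a] = 0 ↔ a ∈ δ(E'(E)) E*³`, Cassels'
"`m` maps into an element of `Ш` if and only if there is everywhere locally a point on (2)" read at
one place, i.e. the local condition defining `Sel^φ` (Silverman X.4.2/X.4.9) is necessary for `Ш`.
[cite: Cassels1964ArithmeticVI, p. 65] [cite: SilvermanAEC2009, Thm. X.4.2(a) and Prop. X.4.9] -/
theorem exists_phiDescent_eq_of_torsorClass_mem_localRestrictionKer {a : K} (ha : a ≠ 0)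
    (hmem : torsorClass hc hD ha ∈ (mordellCurve D).localRestrictionKer E) :
    ∃ (P : (mordellCurve (81 * algebraMap K E c ^ 2)).toAffine.Point) (w : E),
      w ≠ 0 ∧ phiDescent (algebraMap K E c) P = algebraMap K E a * w ^ 3 := by
  haveI : CharZero E := charZero_of_injective_algebraMap (algebraMap K E).injective
  have hV := isVeluThreePair_local (E := E) hc hD
  have hθ := thetaE_sq (K := K) (E := E)
  have hιinj : Function.Injective (iotaE (K := K) E) := (iotaE (K := K) E).toRingHom.injective
  have hEinj : Function.Injective (algebraMap E (AlgebraicClosure E)) :=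
    (algebraMap E (AlgebraicClosure E)).injective
  have hcE0 : cE E c ≠ 0 := by
    rw [cE, map_ne_zero_iff _ (algebraMap K (AlgebraicClosure E)).injective]; exact hc
  have hcE' : cE E c = algebraMap E (AlgebraicClosure E) (algebraMap K E c) := cE_eq c
  have hcEK : algebraMap K E c ≠ 0 := (map_ne_zero_iff _ (algebraMap K E).injective).mpr hc
  have haEK : algebraMap K E a ≠ 0 := (map_ne_zero_iff _ (algebraMap K E).injective).mpr ha
  have hω3 : iotaE (K := K) E (omega K) ^ 3 = 1 := iotaE_omega_pow_three
  have hωθ : iotaE (K := K) E (omega K) = (thetaE K E - 1) / 2 := iotaE_omega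
  have hω0 : iotaE (K := K) E (omega K) ≠ 0 := fun h => by rw [h] at hω3; norm_num at hω3
  have hω2 : ((-thetaE K E - 1) / 2) = iotaE (K := K) E (omega K) ^ 2 := by
    rw [hωθ]; field_simp; linear_combination -hθ
  have hα3 : iotaE (K := K) E (cubeRoot a) ^ 3 = algebraMap K (AlgebraicClosure E) a := by
    rw [← map_pow, cubeRoot_pow_three, AlgHom.commutes]
  have hα0 : iotaE (K := K) E (cubeRoot a) ≠ 0 := (map_ne_zero_iff _ hιinj).mpr (cubeRoot_ne_zero ha)
  have haE : algebraMap K (AlgebraicClosure E) a = algebraMap E (AlgebraicClosure E) (algebraMap K E a) :=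
    IsScalarTower.algebraMap_apply K E (AlgebraicClosure E) a
  have hτα : ∀ τ : Field.absoluteGaloisGroup E, galAutE E τ (iotaE (K := K) E (cubeRoot a)) =
      iotaE (K := K) E (omega K) ^ (kummerExp a (resGal (K := K) E τ)).val * iotaE (K := K) E (cubeRoot a) :=
    fun τ => galAutE_iotaE_cubeRoot ha τ
  -- notation for the exponent `n(τ) = kummerExp a (τ|_K̄)`
  set n : Field.absoluteGaloisGroup E → ZMod 3 := fun τ => kummerExp a (resGal (K := K) E τ) with hn
  -- the restricted class is a coboundary: `n(τ) T_E = τ b − b`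
  unfold torsorClass WeierstrassCurve.localRestrictionKer at hmem
  rw [oneCocycleClass_mem_resKer_iff] at hmem
  obtain ⟨b, hb⟩ := hmem
  have hpinj : Function.Injective (pointsMap (mordellCurve D) E) :=
    pointsMapOfEmb_injective (mordellCurve D) _
  -- `pointsMap (n(τ) T) = τ b − b`, and `n(τ) T_E` as a local point
  have hbχ : ∀ τ : Field.absoluteGaloisGroup E,
      pointsMap (mordellCurve D) E (chiT hc hD (n τ)) = τ • b - b := fun τ => hb τ
  set TE : localPoints (mordellCurve D) E := hV.T with hTE
  have hχT : ∀ k : ZMod 3, pointsMap (mordellCurve D) E (chiT hc hD k) = k.val • TE := fun k => by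
    rw [chiT_eq_val_nsmul, pointsMap_nsmul_torsT]
    rfl
  have hσb : ∀ τ : Field.absoluteGaloisGroup E, τ • b = b + (n τ).val • TE := fun τ => by
    rw [← hχT, hbχ τ, add_sub_cancel]
  -- `τ (jT_E) − jT_E = ((ε(τ) − 1) j) T_E`, through `pointsMap`
  have hcob : ∀ (τ : Field.absoluteGaloisGroup E) (j : ZMod 3),
      τ • pointsMap (mordellCurve D) E (chiT hc hD j) - pointsMap (mordellCurve D) E (chiT hc hD j) =
        pointsMap (mordellCurve D) E (chiT hc hD ((eps (resGal (K := K) E τ) - 1) * j)) := fun τ j => by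
    rw [chiT_eps_sub_one_mul, map_sub, pointsMap_smul]
  /- the CUBE CASE: if `n(τ) = (ε(τ) − 1) j` on `Γ_E` then `ι(ω)^{−j} ι∛a ∈ E` and `a ∈ E*³`,
  so `P' = O` works -/
  have cube_case : ∀ j : ZMod 3, (∀ τ : Field.absoluteGaloisGroup E, n τ = (eps (resGal (K := K) E τ) - 1) * j) →
      ∃ (P : (mordellCurve (81 * algebraMap K E c ^ 2)).toAffine.Point) (w : E),
        w ≠ 0 ∧ phiDescent (algebraMap K E c) P = algebraMap K E a * w ^ 3 := by
    intro j hj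
    set α' : AlgebraicClosure E := iotaE (K := K) E (omega K ^ (-j).val) * iotaE (K := K) E (cubeRoot a)
      with hα'
    have hfix : ∀ τ : Field.absoluteGaloisGroup E, galAutE E τ α' = α' := by
      intro τ
      rw [hα', map_mul, hτα τ, ← iotaE_galAut_resGal, galAut_omega_pow, ← mul_assoc, ← map_pow,
        ← map_mul, ← pow_add]
      congr 2
      rw [omega_pow_eq_pow_iff]
      push_cast
      rw [epsNat_cast, ZMod.natCast_zmod_val, ZMod.natCast_zmod_val, show kummerExp a (resGal (K := K) E τ) = n τ from rfl,
        hj τ]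
      ring
    obtain ⟨b₀, hb₀⟩ := exists_algebraMap_eq_of_forall_galAutE hfix
    have hb₀3 : algebraMap E (AlgebraicClosure E) (b₀ ^ 3) = algebraMap E (AlgebraicClosure E) (algebraMap K E a) := by
      rw [map_pow, hb₀, hα', mul_pow, ← map_pow, ← pow_mul, mul_comm (-j).val 3, pow_mul, omega_pow_three,
        one_pow, map_one, one_mul, hα3, haE]
    have hab : algebraMap K E a = b₀ ^ 3 := (hEinj hb₀3).symm
    have hb₀0 : b₀ ≠ 0 := by rintro rfl; exact haEK (by rw [hab]; ring)
    refine ⟨0, b₀⁻¹, inv_ne_zero hb₀0, ?_⟩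
    rw [phiDescent_zero, hab, inv_pow, mul_inv_cancel₀ (pow_ne_zero 3 hb₀0)]
  rcases b with _ | ⟨xb, yb, hxyb⟩
  · -- `b = O`: the restricted cocycle vanishes, `n = 0`
    refine cube_case 0 fun τ => chiT_injective hc hD (hpinj ?_)
    rw [mul_zero, map_zero, map_zero, hbχ τ]
    change τ • (0 : localPoints (mordellCurve D) E) - 0 = 0
    rw [smul_zero, sub_zero]
  · by_cases hxb : xb = 0
    · -- `b = ±T_E = pointsMap (±T)`: `n(τ) T_E = (ε(τ) − 1)(±T_E)`
      rcases hV.some_eq_T_or hxyb hxb with hbT | hbT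
      · refine cube_case 1 fun τ => chiT_injective hc hD (hpinj ?_)
        have h1 : (Affine.Point.some xb yb hxyb : localPoints (mordellCurve D) E) =
            pointsMap (mordellCurve D) E (chiT hc hD 1) := by
          rw [chiT_one, pointsMap_torsT]; exact hbT
        rw [hbχ τ, h1, hcob]
      · refine cube_case (-1) fun τ => chiT_injective hc hD (hpinj ?_)
        have h1 : (Affine.Point.some xb yb hxyb : localPoints (mordellCurve D) E) =
            pointsMap (mordellCurve D) E (chiT hc hD (-1)) := by
          rw [map_neg, chiT_one, map_neg, pointsMap_torsT]; exact hbT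
        rw [hbχ τ, h1, hcob]
    · /- MAIN CASE `b = (x, y)`, `x ≠ 0`: `P' = φ(b)` is `Γ_E`-invariant, hence `E`-rational -/
      set b : localPoints (mordellCurve D) E := Affine.Point.some xb yb hxyb with hbdef
      -- `τ b = b + n(τ) T_E` in coordinates: `τ b = (τ x, τ y) = (x', y')` with `x' ≠ 0`
      have hmove : ∀ τ : Field.absoluteGaloisGroup E, ∃ (x' y' : AlgebraicClosure E)
          (h' : ((mordellCurve D).baseChange (AlgebraicClosure E)).toAffine.Nonsingular x' y'),
          Affine.Point.some xb yb hxyb + (n τ).val • hV.T = Affine.Point.some x' y' h' ∧ x' ≠ 0 ∧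
            galAutE E τ xb = x' ∧ galAutE E τ yb = y' := by
        intro τ
        obtain ⟨x', y', h', hQ, hx'⟩ := exists_eq_some_of_add_nsmul_T hV hxyb hxb (n τ).val
        have hτb : τ • b = (Affine.Point.some (galAutE E τ xb) (galAutE E τ yb) (nonsingular_galAutE τ hxyb) :
            localPoints (mordellCurve D) E) :=
          smul_localPoints_some τ hxyb (nonsingular_galAutE τ hxyb)
        have e : τ • b = (Affine.Point.some x' y' h' : localPoints (mordellCurve D) E) := (hσb τ).trans hQ
        rw [hτb] at e
        obtain ⟨h1, h2⟩ := Affine.Point.some.inj e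
        exact ⟨x', y', h', hQ, hx', h1, h2⟩
      -- the Vélu coordinates have coefficients fixed by `Γ_E`, so `φ(b)` is `Γ_E`-fixed: `φ(τ b) = φ(b + nT) = φ(b)`
      have hXform : ∀ x : AlgebraicClosure E, hV.X x = (x ^ 3 - 12 * cE E c ^ 2) / x ^ 2 :=
        fun x => IsVeluPair.X_eq' hV hθ x
      have hYform : ∀ x y : AlgebraicClosure E, hV.Y x y = y * (x ^ 3 + 24 * cE E c ^ 2) / x ^ 3 :=
        fun x y => IsVeluPair.Y_eq' hV hθ x y
      have hfixX : ∀ τ : Field.absoluteGaloisGroup E,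
          galAutE E τ (hV.X xb) = hV.X xb ∧ galAutE E τ (hV.Y xb yb) = hV.Y xb yb := by
        intro τ
        obtain ⟨x', y', h', hQ, hx', hτx, hτy⟩ := hmove τ
        have hφ : hV.pointFun (Affine.Point.some x' y' h') = hV.pointFun (Affine.Point.some xb yb hxyb) := by
          rw [← hQ, ← hV.pointHom_apply, map_add, map_nsmul, hV.pointHom_apply, hV.pointHom_apply,
            hV.pointFun_T, smul_zero, add_zero]
        rw [hV.pointFun_some _ hx', hV.pointFun_some _ hxb] at hφ
        obtain ⟨hX', hY'⟩ := Affine.Point.some.inj hφ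
        constructor
        · calc galAutE E τ (hV.X xb) = hV.X (galAutE E τ xb) := by
                rw [hXform xb, hXform (galAutE E τ xb)]
                simp only [map_div₀, map_sub, map_pow, map_mul, map_ofNat, galAutE_cE]
            _ = hV.X xb := by rw [hτx, hX']
        · calc galAutE E τ (hV.Y xb yb) = hV.Y (galAutE E τ xb) (galAutE E τ yb) := by
                rw [hYform xb yb, hYform (galAutE E τ xb) (galAutE E τ yb)]
                simp only [map_div₀, map_add, map_pow, map_mul, map_ofNat, galAutE_cE]
            _ = hV.Y xb yb := by rw [hτx, hτy, hY']
      obtain ⟨X₀, hX₀⟩ := exists_algebraMap_eq_of_forall_galAutE fun τ => (hfixX τ).1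
      obtain ⟨Y₀, hY₀⟩ := exists_algebraMap_eq_of_forall_galAutE fun τ => (hfixX τ).2
      -- `P' = (X₀, Y₀)` lies on `E'` over `E`
      have hE'bar : hV.Y xb yb ^ 2 = hV.X xb ^ 3 + 81 * cE E c ^ 2 := by
        have h1 := hV.equation_image hxyb.left hxb
        rw [hV.equation'_iff] at h1
        linear_combination h1 - 27 * cE E c ^ 2 * hθ
      have hE'E : Y₀ ^ 2 = X₀ ^ 3 + 81 * algebraMap K E c ^ 2 := by
        apply hEinj
        simp only [map_add, map_pow, map_mul, map_ofNat]
        rw [hX₀, hY₀, ← hcE', hE'bar]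
      have hEq' : (mordellCurve (81 * algebraMap K E c ^ 2)).toAffine.Equation X₀ Y₀ :=
        (mordellCurve_equation_iff _ _ _).mpr hE'E
      have hc81 : (81 : E) * algebraMap K E c ^ 2 ≠ 0 := mul_ne_zero (by norm_num) (pow_ne_zero 2 hcEK)
      have hns := nonsingular_mordellCurve_of_equation hc81 hEq'
      /- the `g`-function argument over `Ē`: for `ε = ±1` with `(ε ι√−3 − 1)/2 = ι(ω)^m`, `m + e = 3`,
      `g_{εc}(b) (ι∛a)^e` is `Γ_E`-fixed and its cube is `(Y(P') + 9εc) a^e` -/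
      have gArg : ∀ (ε : AlgebraicClosure E) (m e : ℕ), ε ^ 2 = 1 → (∀ τ : Field.absoluteGaloisGroup E, galAutE E τ ε = ε) →
          (ε * thetaE K E - 1) / 2 = iotaE (K := K) E (omega K) ^ m → m + e = 3 →
          ∃ w : E, algebraMap E (AlgebraicClosure E) w ^ 3 =
            (hV.Y xb yb + 9 * (ε * cE E c)) * algebraMap K (AlgebraicClosure E) a ^ e := by
        intro ε m e hε hεfix hm hme
        set g := gFunW (ε * cE E c) b with hg
        have he2 : (ε * cE E c) ^ 2 = cE E c ^ 2 := by rw [mul_pow, hε, one_mul]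
        have hg3 : g ^ 3 = hV.Y xb yb + 9 * (ε * cE E c) := by
          rw [hg, hbdef]; exact gFunW_pow_three hV hθ he2 hxyb hxb
        have hσg : ∀ τ : Field.absoluteGaloisGroup E,
            galAutE E τ g = iotaE (K := K) E (omega K) ^ (m * (n τ).val) * g := by
          intro τ
          -- `τ g = g_{εc}(τ b) = g_{εc}(b + nT) = ((εθ−1)/2)^n g`
          obtain ⟨x', y', h', hQ, hx', hτx, hτy⟩ := hmove τ
          have h1 : galAutE E τ g = gFunW (ε * cE E c) (Affine.Point.some x' y' h') := by
            rw [hg, hbdef, gFunW_some, gFunW_some, map_div₀, map_add, map_mul, map_mul, hεfix, galAutE_cE,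
              map_ofNat, hτx, hτy]
          rw [h1, ← hQ, gFunW_add_nsmul_T hV hθ hcE0 hε _ (n τ).val, hm, ← pow_mul, hg, hbdef]
        set wt := g * iotaE (K := K) E (cubeRoot a) ^ e with hwt
        have hfix : ∀ τ : Field.absoluteGaloisGroup E, galAutE E τ wt = wt := by
          intro τ
          have h3 : m * (n τ).val + (n τ).val * e = 3 * (n τ).val := by
            rw [mul_comm m, ← mul_add, hme, mul_comm]
          have hω : iotaE (K := K) E (omega K) ^ (m * (n τ).val) *
              iotaE (K := K) E (omega K) ^ ((n τ).val * e) = 1 := by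
            rw [← pow_add, h3, pow_mul, hω3, one_pow]
          rw [hwt, map_mul, map_pow, hσg τ, hτα τ, mul_pow, ← pow_mul]
          calc iotaE (K := K) E (omega K) ^ (m * (n τ).val) * g *
                (iotaE (K := K) E (omega K) ^ ((n τ).val * e) * iotaE (K := K) E (cubeRoot a) ^ e)
              = (iotaE (K := K) E (omega K) ^ (m * (n τ).val) * iotaE (K := K) E (omega K) ^ ((n τ).val * e)) *
                  (g * iotaE (K := K) E (cubeRoot a) ^ e) := by ring
            _ = g * iotaE (K := K) E (cubeRoot a) ^ e := by rw [hω, one_mul]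
        obtain ⟨w, hw⟩ := exists_algebraMap_eq_of_forall_galAutE hfix
        refine ⟨w, ?_⟩
        rw [hw, hwt, mul_pow, ← pow_mul, mul_comm e 3, pow_mul, hα3, hg3]
      by_cases hY : Y₀ = -(9 * algebraMap K E c)
      · -- `P' = −T'`: use `g_{−c}`, moved by `ω²`; `w³ = (Y₀ − 9c) a = −18 c a`
        have hm : ((-1 : AlgebraicClosure E) * thetaE K E - 1) / 2 = iotaE (K := K) E (omega K) ^ 2 := by
          rw [← hω2]; ring
        obtain ⟨w, hw⟩ := gArg (-1) 2 1 (by norm_num) (fun τ => by rw [map_neg, map_one]) hm rfl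
        have hwK : w ^ 3 = -(18 * algebraMap K E c) * algebraMap K E a := by
          apply hEinj
          rw [map_pow, hw, pow_one, ← hY₀, hY, haE, hcE']
          simp only [map_mul, map_neg, map_ofNat]
          ring
        have hw0 : w ≠ 0 := by
          rintro rfl
          have : -(18 * algebraMap K E c) * algebraMap K E a = 0 := by rw [← hwK]; ring
          exact mul_ne_zero (neg_ne_zero.mpr (mul_ne_zero (by norm_num) hcEK)) haEK this
        refine ⟨Affine.Point.some X₀ Y₀ hns, -(18 * algebraMap K E c) / w, div_ne_zero
          (neg_ne_zero.mpr (mul_ne_zero (by norm_num) hcEK)) hw0, ?_⟩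
        rw [phiDescent_some, if_pos hY, div_pow, hwK]
        field_simp
      · -- generic `P'`: use `g_c`, moved by `ω`; `w³ = (Y₀ + 9c) a²`
        have hm : ((1 : AlgebraicClosure E) * thetaE K E - 1) / 2 = iotaE (K := K) E (omega K) ^ 1 := by
          rw [pow_one, one_mul, hωθ]
        obtain ⟨w, hw⟩ := gArg 1 1 2 (by norm_num) (fun τ => by rw [map_one]) hm rfl
        have hwK : w ^ 3 = (Y₀ + 9 * algebraMap K E c) * algebraMap K E a ^ 2 := by
          apply hEinj
          rw [map_pow, hw, ← hY₀, haE, hcE']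
          simp only [map_mul, map_add, map_pow, map_ofNat]
          ring
        have hY9 : Y₀ + 9 * algebraMap K E c ≠ 0 := fun h => hY (by linear_combination h)
        have hw0 : w ≠ 0 := by
          rintro rfl
          have : (Y₀ + 9 * algebraMap K E c) * algebraMap K E a ^ 2 = 0 := by rw [← hwK]; ring
          exact mul_ne_zero hY9 (pow_ne_zero 2 haEK) this
        refine ⟨Affine.Point.some X₀ Y₀ hns, w / algebraMap K E a, div_ne_zero hw0 haEK, ?_⟩
        rw [phiDescent_some, if_neg hY, div_pow, hwK]
        field_simp

/-- **The local condition is an equivalence**: `res_E [C_a] = 0` in `H¹(E, E_D(Ē))` iff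
`a ∈ δ(E'(E)) · E*³` (Cassels, p. 65: "if and only if there is everywhere locally a point on (2)",
at one place; Silverman X.4.2(a)/X.4.9: the local conditions of `Sel^φ`).
[cite: Cassels1964ArithmeticVI, p. 65] [cite: SilvermanAEC2009, Thm. X.4.2(a) and Prop. X.4.9] -/
theorem torsorClass_mem_localRestrictionKer_iff {a : K} (ha : a ≠ 0) :
    torsorClass hc hD ha ∈ (mordellCurve D).localRestrictionKer E ↔
      ∃ (P : (mordellCurve (81 * algebraMap K E c ^ 2)).toAffine.Point) (w : E),
        w ≠ 0 ∧ phiDescent (algebraMap K E c) P = algebraMap K E a * w ^ 3 :=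
  ⟨exists_phiDescent_eq_of_torsorClass_mem_localRestrictionKer hc hD ha,
    torsorClass_mem_localRestrictionKer hc hD ha⟩

/-- **The local conditions are necessary for `Ш`** (over a number field `K`): if `[C_a] ∈ Ш(E_D/K)`
then `a` is a descent value over every completion `K_v` (finite places) — the input through which
explicit confinements of the local images `δ(E'(K_v))` bound `Ш(E_D/K) ∩ im [C_·] = Ш(E_D/K)[φ]`.
[cite: SilvermanAEC2009, Thm. X.4.2(a) and Prop. X.4.9] -/
theorem exists_phiDescent_eq_adicCompletion_of_torsorClass_mem_sha [NumberField K] {a : K} (ha : a ≠ 0)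
    (hsha : torsorClass hc hD ha ∈ (mordellCurve D).sha)
    (v : IsDedekindDomain.HeightOneSpectrum (NumberField.RingOfIntegers K)) :
    ∃ (P : (mordellCurve (81 * algebraMap K (v.adicCompletion K) c ^ 2)).toAffine.Point)
      (w : v.adicCompletion K), w ≠ 0 ∧
        phiDescent (algebraMap K (v.adicCompletion K) c) P = algebraMap K (v.adicCompletion K) a * w ^ 3 := by
  refine exists_phiDescent_eq_of_torsorClass_mem_localRestrictionKer hc hD ha ?_
  rw [WeierstrassCurve.mem_sha_iff] at hsha
  exact hsha.1 v

/-- The same at the infinite places. [cite: SilvermanAEC2009, Thm. X.4.2(a) and Prop. X.4.9] -/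
theorem exists_phiDescent_eq_infinitePlace_of_torsorClass_mem_sha [NumberField K] {a : K} (ha : a ≠ 0)
    (hsha : torsorClass hc hD ha ∈ (mordellCurve D).sha) (w : NumberField.InfinitePlace K) :
    ∃ (P : (mordellCurve (81 * algebraMap K w.Completion c ^ 2)).toAffine.Point)
      (t : w.Completion), t ≠ 0 ∧
        phiDescent (algebraMap K w.Completion c) P = algebraMap K w.Completion a * t ^ 3 := by
  refine exists_phiDescent_eq_of_torsorClass_mem_localRestrictionKer hc hD ha ?_
  rw [WeierstrassCurve.mem_sha_iff] at hsha
  exact hsha.2 w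

end MordellDescent

end Literature.NumberTheory.EllipticCurves
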